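import Summits.SmoothPoincare4.SmoothPoincare4.Theses.InformationMetricHadamard

/-!
# Stub `stub_farCollarImmersive` of line `Sketch` for crux `InformationMetricHadamard.C0AhRecognition`
(item stmt-SmoothPoincare4-6015, route `InformationMetricHadamard`; stub A of the lead's skeleton)

**The `C⁰`-asymptotics make the end collar immersive far out.** Let `Ψ : N × ℝ → W` be a map into a
`5`-manifold carrying a pseudo-Riemannian metric `G`, let `gN` be a Riemannian metric on the
`4`-manifold `N` and `c > 0`. Suppose the crux's asymptotics clause: for every `ε > 0` there is
`t ∈ (0,1)` with
`|G(dΨ(v,s), dΨ(v,s)) - c (s² + gN(v,v))/l²| ≤ ε · c (s² + gN(v,v))/l²` for all `y`, all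
`l ∈ (0,t)` and all tangent vectors `(v,s)` at `(y,l)`. Then for some `t ∈ (0,1)` the differential
`dΨ` is injective at every point of `N × (0,t)`.

Proof (elementary). Take `ε = 1/2` and the corresponding `t`. If `dΨ(v,s) = 0` then the clause reads
`|0 - A| ≤ A/2` with `A = c (s² + gN(v,v))/l² ≥ 0` (positivity of `gN`), whence `A ≤ 0`, so `A = 0`,
so `s² + gN(v,v) = 0`, so `s = 0` and `gN(v,v) = 0`, and finally `v = 0` by positive definiteness
of `gN`. [folklore]
-/

noncomputable section

-- the prescribed namespace `Summit.<P>.<Sub>.…` duplicates `SmoothPoincare4` (P = Sub)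
set_option linter.dupNamespace false

open scoped Manifold ContDiff Topology ENNReal NNReal
open Set Function

namespace Summit.SmoothPoincare4.SmoothPoincare4.Cruxes.C0AhRecognition.Sketch

open Literature.Topology.FourManifolds (HomotopySphere)
open Literature.Geometry.Lorentzian (PseudoRiemannianMetric)

/-- A Riemannian (positive definite) pseudo-Riemannian metric has nonnegative squares:
`0 ≤ gN(v,v)` for every tangent vector `v`. [folklore] -/
private theorem val_self_nonneg_of_isRiemannian
    {N : Type} [TopologicalSpace N] [ChartedSpace (EuclideanSpace ℝ (Fin 4)) N] [IsManifold (𝓡 4) ∞ N]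
    (gN : PseudoRiemannianMetric (𝓡 4) ∞ (EuclideanSpace ℝ (Fin 4)) (TangentSpace (𝓡 4) : N → Type _))
    (hgN : gN.IsRiemannian) (y : N) (v : TangentSpace (𝓡 4) y) : 0 ≤ gN.val y v v := by
  by_cases hv : v = 0
  · subst hv
    simp
  · exact (hgN y v hv).le

/-- Elementary real-number core of stub A: if `|0 - A| ≤ A/2` and `0 ≤ A` then `A = 0`. [folklore] -/
private theorem eq_zero_of_abs_zero_sub_le_half {A : ℝ} (hA : 0 ≤ A)
    (h : |0 - A| ≤ 1 / 2 * A) : A = 0 := by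
  rw [zero_sub, abs_neg, abs_of_nonneg hA] at h
  linarith

/-- **Stub A (`farCollarImmersive`).** If `G ∘ dΨ = (1 + o(1)) c (dl² + gN)/l²` uniformly as
`l → 0` (the crux's asymptotics clause) with `c > 0` and `gN` Riemannian, then for some `t ∈ (0,1)`
the differential of `Ψ` is injective at every point of `N × (0,t)`: with `ε = 1/2`,
`G(dΨ(v,s), dΨ(v,s)) ≥ c (s² + gN(v,v))/(2 l²)`, which vanishes only for `(v,s) = 0`. [folklore] -/
theorem stub_farCollarImmersive
    (N : Type) [TopologicalSpace N] [ChartedSpace (EuclideanSpace ℝ (Fin 4)) N] [IsManifold (𝓡 4) ∞ N]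
    (gN : PseudoRiemannianMetric (𝓡 4) ∞ (EuclideanSpace ℝ (Fin 4)) (TangentSpace (𝓡 4) : N → Type _))
    (hgN : gN.IsRiemannian)
    (W : Type) [TopologicalSpace W] [ChartedSpace (EuclideanSpace ℝ (Fin 5)) W] [IsManifold (𝓡 5) ∞ W]
    (G : PseudoRiemannianMetric (𝓡 5) ∞ (EuclideanSpace ℝ (Fin 5)) (TangentSpace (𝓡 5) : W → Type _))
    (c : ℝ) (Ψ : N × ℝ → W) (hc : 0 < c)
    (hasym : ∀ ε : ℝ, 0 < ε → ∃ t ∈ Ioo (0 : ℝ) 1, ∀ (y : N) (l : ℝ), l ∈ Ioo (0 : ℝ) t →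
      ∀ (v : TangentSpace (𝓡 4) y) (s : ℝ),
        |G.val (Ψ (y, l)) (mfderiv ((𝓡 4).prod 𝓘(ℝ, ℝ)) (𝓡 5) Ψ (y, l) (v, s))
            (mfderiv ((𝓡 4).prod 𝓘(ℝ, ℝ)) (𝓡 5) Ψ (y, l) (v, s)) -
          c * (s ^ 2 + gN.val y v v) / l ^ 2| ≤ ε * (c * (s ^ 2 + gN.val y v v) / l ^ 2)) :
    ∃ t ∈ Ioo (0 : ℝ) 1, ∀ (y : N) (l : ℝ), l ∈ Ioo (0 : ℝ) t →
      Injective (mfderiv ((𝓡 4).prod 𝓘(ℝ, ℝ)) (𝓡 5) Ψ (y, l)) := by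
  obtain ⟨t, ht, h⟩ := hasym (1 / 2) one_half_pos
  refine ⟨t, ht, fun y l hl => ?_⟩
  rw [injective_iff_map_eq_zero]
  intro u hu
  obtain ⟨v, s⟩ := u
  -- the asymptotics clause at `(v, s)`, with `dΨ (v, s) = 0` substituted
  have key : |0 - c * (s ^ 2 + gN.val y v v) / l ^ 2| ≤
      1 / 2 * (c * (s ^ 2 + gN.val y v v) / l ^ 2) := by
    have habs := h y l hl v s
    have h0 : G.val (Ψ (y, l)) (mfderiv ((𝓡 4).prod 𝓘(ℝ, ℝ)) (𝓡 5) Ψ (y, l) (v, s))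
        (mfderiv ((𝓡 4).prod 𝓘(ℝ, ℝ)) (𝓡 5) Ψ (y, l) (v, s)) = 0 := by
      have hz : mfderiv ((𝓡 4).prod 𝓘(ℝ, ℝ)) (𝓡 5) Ψ (y, l) (v, s) = 0 := hu
      rw [hz]
      simp
    rwa [h0] at habs
  have hl0 : 0 < l := hl.1
  have hg0 : 0 ≤ gN.val y v v := val_self_nonneg_of_isRiemannian gN hgN y v
  have hQ : 0 ≤ s ^ 2 + gN.val y v v := by positivity
  have hA : 0 ≤ c * (s ^ 2 + gN.val y v v) / l ^ 2 := by positivity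
  have hA0 : c * (s ^ 2 + gN.val y v v) / l ^ 2 = 0 := eq_zero_of_abs_zero_sub_le_half hA key
  have hQ0 : s ^ 2 + gN.val y v v = 0 := by
    rcases div_eq_zero_iff.mp hA0 with h1 | h1
    · rcases mul_eq_zero.mp h1 with h2 | h2
      · exact absurd h2 hc.ne'
      · exact h2
    · exact absurd h1 (pow_ne_zero 2 hl0.ne')
  have hs : s = 0 := by nlinarith [sq_nonneg s]
  have hv : v = 0 := by
    by_contra hv
    have hpos := hgN y v hv
    nlinarith [sq_nonneg s]
  subst hs
  subst hv
  rfl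

end Summit.SmoothPoincare4.SmoothPoincare4.Cruxes.C0AhRecognition.Sketch

end
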